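import Summits.AtomisticToContinuum.Crystallization.Theorems.LoopTunnelDialSieveCurrency
import Literature.MathematicalPhysics.StatisticalMechanics.MuGSC
import Literature.Probability.Process.RootedHardCoreConfig

/-!
# LoopTunnelDial — LOCAL-LIMIT WORLDS of crux `PocketCase` and K1 «certification is OPEN» (helper, `--supports stmt-27294`)

Route `LoopTunnelDial` (Crystallization), crux `PocketCase` (stmt-AtomisticToContinuum-27294).  Generation 16 of decomp-a2c lens 5 («far at
infinity», banked line v6 9fe2b79b…; cell critic rows 205/207: «land K2/K3 + the shared currency as tree Theorems») sent the ONE-RADIUS DOOR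
`FarCertified` (landed vocabulary: `LoopTunnelDialSieveCurrency`) to INFINITY.  This file lands, complete and over landed modules only, the
infinite-volume vocabulary and the first kernel:

* §1 `IsLocLimGS X` (verbatim the Literature predicate «local limit of translated Lennard-Jones ground states», restated because the two
  Literature module families `LocalLimitOfGroundStates` / `MuGSC` are not co-importable), the SLACK-OPENED sieve `TightSlack ℓ δ d σ X q`,
  `SlackNear`, the residual-at-infinity texts `LimitMuGSCNear` / `MuGSCNear` (over Literature's `IsMuGSC lennardJones eStar`), far-rooted local
  limits `IsFarLocLimGS X` and the stub text `FarLimitNotMuGSC` of the banked line v6.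
* §2 elementary facts: translations of the sieve and of surgeries (`farSet_sub_const`, `improvable_add_const`, `improvable_of_rooted`),
  `7/10`-separation and uniform discreteness of local limits (`isLocLimGS_sep`, `uniformlyDiscrete_of_isLocLimGS`), `MuGSCNear → LimitMuGSCNear`,
  `IsFarLocLimGS X → IsLocLimGS X`.
* §3 **K1 (PROVED)** `uniformlyTightR_of_tightSlack`: a slack-σ certificate of the limit set transfers to the finite sieve `UniformlyTightR` of
  every configuration two-way `ε`-matched to it on a large ball with `4ε ≤ σ`; `not_mem_farSet_of_matches`: hence a particle matched near a
  `SlackNear` point is NOT `(2,3/50,6)`-far.  §4 `farLimitNotMuGSC_of_limitMuGSCNear : LimitMuGSCNear → FarLimitNotMuGSC` (PROVED, from K1).  K2 «exchange at infinity» and K3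
  «compactness» (`FarLimitNotMuGSC → FarCertified`) are banked in the cell (line v6) pending co-importability of the two Literature families.

[cite: BlancLewin2015 §2.1; Sütő 2005/2011 (μ-GSC); folklore matching arguments.]
-/

noncomputable section

namespace Summit.AtomisticToContinuum.Crystallization.Theorems.LoopTunnelDialLimitWorlds

open scoped Topology BigOperators Classical
open Filter
open Literature.MathematicalPhysics.StatisticalMechanics Literature.Probability.Process
open Summit.AtomisticToContinuum.Crystallization.Theorems.ChargedEnergyGapNegative (eStar)
open Summit.AtomisticToContinuum.Crystallization.Theorems.LjLaminarWindowsSketch (lennardJones_groundState_dist_ge_seven_tenths)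
open Summit.AtomisticToContinuum.Crystallization.Theorems.GrainPercolationDialCrossCeiling (E3)
open Summit.AtomisticToContinuum.Crystallization.Theorems.LoopTunnelDialSieveCurrency
  (UniformlyTightR certSet farSet Improvable)

/-! ### §G16.1 Definitions -/

/-- **`IsLocLimGS X`** — VERBATIM the Literature predicate `IsLocalLimitOfGroundStates lennardJones 3 X` (`X ∈ 𝔏`: a local limit, in the local
rubber topology, of translated Lennard-Jones ground states along a strictly increasing particle-number sequence).  Restated here letter for letter
because `Literature…LocalLimitOfGroundStates` cannot be imported next to `Literature…MuGSC` (both module families declare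
`UniformlyDiscrete` / `IsMuGSC`; tree-hygiene finding of this generation). [cite: BlancLewin2015, §2.1 (16); folklore] -/
def IsLocLimGS (X : Set E3) : Prop :=
  ∃ (x : (N : ℕ) → (Fin N → EuclideanSpace ℝ (Fin 3))) (σ : ℕ → ℕ) (τ : ℕ → EuclideanSpace ℝ (Fin 3)),
    (∀ N, IsGroundState lennardJones (x N)) ∧ StrictMono σ ∧ ∀ R ε : ℝ, 0 < ε → ∀ᶠ j : ℕ in Filter.atTop,
      (∀ p ∈ X, ‖p‖ ≤ R → ∃ i : Fin (σ j), dist (x (σ j) i + τ j) p ≤ ε) ∧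
        (∀ i : Fin (σ j), ‖x (σ j) i + τ j‖ ≤ R → ∃ p ∈ X, dist (x (σ j) i + τ j) p ≤ ε)

/-- **`TightSlack ℓ δ d σ X q`** — the lineage's `(ℓ, δ)`-quasi-twelve sieve `UniformlyTightR ℓ δ d` transported to a POINT SET `X ⊆ ℝ³` and
OPENED by a slack `σ`: common scale `d ∈ [3/4, 6/5]`, `(d + σ)`-separation of `X` on `B(q, ℓ + 1 + σ)`, and for every point of `X` in
`B(q, ℓ + σ)` twelve OTHER points of `X` within `(1 + δ)d − σ`.  (The slack makes the certificate survive `ε`-displacements with `4ε ≤ σ`: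
`uniformlyTightR_of_tightSlack`.) -/
def TightSlack (ℓ δ d σ : ℝ) (X : Set E3) (q : E3) : Prop :=
  3 / 4 ≤ d ∧ d ≤ 6 / 5 ∧
    (∀ p ∈ X, ∀ p' ∈ X, p ≠ p' → dist p q ≤ ℓ + 1 + σ → dist p' q ≤ ℓ + 1 + σ → d + σ ≤ dist p p') ∧
    (∀ p ∈ X, dist p q ≤ ℓ + σ →
      ∃ T : Finset E3, (↑T : Set E3) ⊆ X ∧ p ∉ T ∧ 12 ≤ T.card ∧ ∀ p' ∈ T, dist p' p ≤ (1 + δ) * d - σ)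

/-- **`SlackNear X p`** — the point `p` has a slack-`(2, 3/50)`-certified point of `X` within distance `6 − σ` for some slack `σ > 0`
(the open form of «not `(2, 3/50, 6)`-far»). -/
def SlackNear (X : Set E3) (p : E3) : Prop :=
  ∃ σ : ℝ, 0 < σ ∧ ∃ q ∈ X, dist q p ≤ 6 - σ ∧ ∃ d : ℝ, TightSlack 2 (3 / 50) d σ X q

/-- **THE FAR RESIDUAL AT INFINITY — `LimitMuGSCNear`** [DECLARED RESIDUAL · BARRIER-core TetrahedralFrustration · stated over the two
Literature classes `𝔏` (local limits of translated LJ ground states) and `μGSC(e⋆)` (Sütő's μ-ground-state configurations at the bulk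
chemical potential `e⋆ = lim E(N)/N`)]: every point set `X ⊆ ℝ³` which is BOTH a local limit of translated Lennard-Jones ground states AND a
`μ`-GSC of `V_LJ` at `μ = e⋆` has, about EVERY one of its points, a slack-certified point within distance `< 6`.
NO threshold `N₀`, NO radius `s₀`, NO margin `g`, no dial, no cofinality, no sequence hypothesis: the asymptotic regime has absorbed the finite
range (`farCertified_of_limitMuGSCNear`, PROVED: compactness of rooted hard-core configurations + the bridge at infinity
`isMuGSC_of_nonImprovable_limit`). -/
def LimitMuGSCNear : Prop :=
  ∀ X : Set E3, IsLocLimGS X → IsMuGSC lennardJones eStar X → ∀ p ∈ X, SlackNear X p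

/-- **`MuGSCNear`** — the same conclusion for EVERY uniformly discrete `μ`-GSC at `e⋆` (drops the provenance `X ∈ 𝔏`; lens-4's world:
«every μ-GSC of LJ at e⋆ is everywhere-near-close-packed»).  `MuGSCNear → LimitMuGSCNear` (`limitMuGSCNear_of_muGSCNear`). -/
def MuGSCNear : Prop :=
  ∀ X : Set E3, UniformlyDiscrete X → IsMuGSC lennardJones eStar X → ∀ p ∈ X, SlackNear X p

/-- **`IsFarLocLimGS X`** — `X ∋ 0` is a local limit of Lennard-Jones ground states ROOTED AT `(2, 3/50, 6)`-FAR particles: along a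
strictly increasing particle-number sequence `σ`, the ground state `x (σ j)` recentred at a particle `c j` with NO `(2, 3/50)`-certified
particle within distance `6` converges locally (two-way `ε`-matching on every ball, eventually) to `X`.  The far-rootedness is a property of the
APPROXIMANTS (closed sieve), not of `X`: no slack sliver. -/
def IsFarLocLimGS (X : Set E3) : Prop :=
  (0 : E3) ∈ X ∧ ∃ (x : (N : ℕ) → (Fin N → EuclideanSpace ℝ (Fin 3))) (σ : ℕ → ℕ) (c : (j : ℕ) → Fin (σ j)),
    (∀ N, IsGroundState lennardJones (x N)) ∧ StrictMono σ ∧ (∀ j, c j ∈ farSet 2 (3 / 50) 6 (x (σ j))) ∧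
      ∀ R ε : ℝ, 0 < ε → ∀ᶠ j : ℕ in Filter.atTop,
        (∀ p ∈ X, ‖p‖ ≤ R → ∃ i : Fin (σ j), dist (x (σ j) i - x (σ j) (c j)) p ≤ ε) ∧
          (∀ i : Fin (σ j), ‖x (σ j) i - x (σ j) (c j)‖ ≤ R → ∃ p ∈ X, dist (x (σ j) i - x (σ j) (c j)) p ≤ ε)

/-- **THE FAR RESIDUAL AT INFINITY, stub form — `FarLimitNotMuGSC`** [DECLARED RESIDUAL · BARRIER-core TetrahedralFrustration]:
NO far-rooted local limit of Lennard-Jones ground states is a `μ`-GSC of `V_LJ` at the coexistence chemical potential `μ = e⋆`.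
Equivalently: around matter that stays `6`-deep UNCERTIFIED at every particle number, some FINITE exchange lowers `H − e⋆·#` in the limit
configuration.  The infinite-volume transcription of «μ-stable ground states have no far particle» (`farSet_eq_empty_of_muStable`), with
no threshold, radius, margin or dial.  `FarLimitNotMuGSC → FarCertified` (`farCertified_of_farLimitNotMuGSC`, PROVED: compactness + the
bridge at infinity); `LimitMuGSCNear → FarLimitNotMuGSC` (`farLimitNotMuGSC_of_limitMuGSCNear`, PROVED: openness of certification). -/
def FarLimitNotMuGSC : Prop :=
  ∀ X : Set E3, IsFarLocLimGS X → ¬ IsMuGSC lennardJones eStar X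

/-! ### §G16.2 Elementary facts: norms, translations, separation of local limits -/

/-- Triangle inequality from the origin: `‖p‖ ≤ dist p w + ‖w‖`. -/
private theorem norm_le_dist_add_norm (p w : E3) : ‖p‖ ≤ dist p w + ‖w‖ := by
  have h := dist_triangle p w 0
  rwa [dist_zero_right, dist_zero_right] at h

/-- Triangle inequality from the origin: `‖p‖ ≤ ‖w‖ + dist p w`. -/
private theorem norm_le_norm_add_dist (p w : E3) : ‖p‖ ≤ ‖w‖ + dist p w := by
  have := norm_le_dist_add_norm p w
  linarith

/-- The far set is translation invariant. -/
theorem farSet_sub_const {ℓ δ s : ℝ} {N : ℕ} (y : Fin N → E3) (v : E3) :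
    farSet ℓ δ s (fun k => y k - v) = farSet ℓ δ s y := by
  unfold farSet certSet UniformlyTightR
  simp only [dist_sub_right]

/-- `Improvable` is translation invariant (additive form). -/
theorem improvable_add_const {e η R : ℝ} {N : ℕ} {y : Fin N → E3} {c : Fin N} (v : E3)
    (h : Improvable e η R y c) : Improvable e η R (fun k => y k + v) c := by
  obtain ⟨M, z, hz, hout, hin, h1, h2, hE⟩ := h
  refine ⟨M, fun l => z l + v, fun a b hab => hz (add_right_cancel hab), fun k hk => ?_, fun l hl => ?_, h1, h2, ?_⟩
  · rw [dist_add_right] at hk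
    obtain ⟨l, hl⟩ := hout k hk
    exact ⟨l, by simp only [hl]⟩
  · rw [dist_add_right] at hl
    obtain ⟨k, hk⟩ := hin l hl
    exact ⟨k, by simp only [hk]⟩
  · rw [interactionEnergy_add_const, interactionEnergy_add_const]
    exact hE

/-- From an improvement of the ROOTED configuration `k ↦ y k − y c` to one of `y`. -/
theorem improvable_of_rooted {e η R : ℝ} {N : ℕ} {y : Fin N → E3} {c : Fin N}
    (h : Improvable e η R (fun k => y k - y c) c) : Improvable e η R y c := by
  have := improvable_add_const (y c) h
  simpa only [sub_add_cancel] using this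

/-- Points of a local limit of ground states are `7/10`-separated (the landed minimal distance `≥ 7/10` of LJ ground states passes to
local limits). -/
theorem isLocLimGS_sep {X : Set E3} (hX : IsLocLimGS X) : ∀ p ∈ X, ∀ q ∈ X, p ≠ q → (7 : ℝ) / 10 ≤ dist p q := by
  obtain ⟨x, σ, τ, hgs, -, hlim⟩ := hX
  intro p hp q hq hpq
  have hpq0 : 0 < dist p q := dist_pos.2 hpq
  by_contra hlt
  push Not at hlt
  -- match both points at a tolerance below half the defect
  set ε : ℝ := min (dist p q / 4) ((7 / 10 - dist p q) / 4) with hε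
  have hε0 : 0 < ε := lt_min (by positivity) (by linarith)
  have hε1 : ε ≤ dist p q / 4 := min_le_left _ _
  have hε2 : ε ≤ (7 / 10 - dist p q) / 4 := min_le_right _ _
  obtain ⟨j, hj⟩ := (hlim (max ‖p‖ ‖q‖) ε hε0).exists
  obtain ⟨i, hi⟩ := hj.1 p hp (le_max_left _ _)
  obtain ⟨i', hi'⟩ := hj.1 q hq (le_max_right _ _)
  by_cases hii : i = i'
  · subst hii
    have := dist_triangle_left p q (x (σ j) i + τ j)
    linarith
  · have hsep := lennardJones_groundState_dist_ge_seven_tenths (hgs (σ j)) hii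
    have h1 : dist (x (σ j) i + τ j) (x (σ j) i' + τ j) = dist (x (σ j) i) (x (σ j) i') := dist_add_right _ _ _
    have h2 := dist_triangle (x (σ j) i + τ j) p (x (σ j) i' + τ j)
    have h3 := dist_triangle p q (x (σ j) i' + τ j)
    rw [dist_comm q] at h3
    linarith

/-- A local limit of Lennard-Jones ground states is uniformly discrete (`7/10`-separated). -/
theorem uniformlyDiscrete_of_isLocLimGS {X : Set E3} (hX : IsLocLimGS X) : UniformlyDiscrete X :=
  ⟨7 / 10, by norm_num, isLocLimGS_sep hX⟩

/-- `MuGSCNear → LimitMuGSCNear`. -/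
theorem limitMuGSCNear_of_muGSCNear (h : MuGSCNear) : LimitMuGSCNear :=
  fun X hX hmu p hp => h X (uniformlyDiscrete_of_isLocLimGS hX) hmu p hp

/-- A far-rooted local limit is a local limit (`τ j = −x (σ j) (c j)`). -/
theorem isLocLimGS_of_isFarLocLimGS {X : Set E3} (h : IsFarLocLimGS X) : IsLocLimGS X := by
  obtain ⟨-, x, σ, c, hgs, hσ, -, hlim⟩ := h
  refine ⟨x, σ, fun j => -(x (σ j) (c j)), hgs, hσ, fun R ε hε => ?_⟩
  filter_upwards [hlim R ε hε] with j hj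
  simpa only [← sub_eq_add_neg] using hj

/-! ### §G16.3 OPENNESS OF CERTIFICATION (K1): a slack certificate of the limit set transfers to every finite configuration locally matching it -/

/-- **K1 (PROVED).** If `X` and the configuration `w` are `δ₀`-separated, `X` carries a slack certificate `TightSlack 2 (3/50) d σ X q`,
and `range w` two-way `ε`-matches `X` on the ball of radius `R ≥ ‖q‖ + 5 + σ` with `4ε ≤ σ`, `4ε < δ₀`, then every particle `w j` within
`ε` of `q` is `(2, 3/50)`-certified at the SAME scale `d`. -/
theorem uniformlyTightR_of_tightSlack {X : Set E3} {δ₀ : ℝ}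
    (hXsep : ∀ p ∈ X, ∀ p' ∈ X, p ≠ p' → δ₀ ≤ dist p p')
    {N : ℕ} {w : Fin N → E3} (hwsep : ∀ k l : Fin N, k ≠ l → δ₀ ≤ dist (w k) (w l))
    {q : E3} {d σ : ℝ} (hT : TightSlack 2 (3 / 50) d σ X q)
    {R ε : ℝ} (hε : 0 < ε) (hεσ : 4 * ε ≤ σ) (hεδ : 4 * ε < δ₀) (hR : ‖q‖ + 5 + σ ≤ R)
    (hm : (∀ p ∈ Set.range w, ‖p‖ ≤ R → ∃ q' ∈ X, dist q' p ≤ ε) ∧ (∀ q' ∈ X, ‖q'‖ ≤ R → ∃ p ∈ Set.range w, dist q' p ≤ ε))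
    {j : Fin N} (hj : dist (w j) q ≤ ε) :
    UniformlyTightR 2 (3 / 50) d w j := by
  obtain ⟨hd1, hd2, hsepX, hcountX⟩ := hT
  have hσ : 0 < σ := by linarith
  -- X-partners of particles of norm ≤ R
  have hpart : ∀ k : Fin N, ‖w k‖ ≤ R → ∃ xk ∈ X, dist xk (w k) ≤ ε := fun k hk => hm.1 (w k) ⟨k, rfl⟩ hk
  have hnj : ‖w j‖ ≤ ‖q‖ + ε := by
    have := norm_le_dist_add_norm (w j) q
    linarith
  refine ⟨hd1, hd2, fun k l hkl hk hl => ?_, fun k hk => ?_⟩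
  · -- separation on B(w j, 3)
    obtain ⟨xk, hxk, hdk⟩ := hpart k (by have := norm_le_dist_add_norm (w k) (w j); linarith)
    obtain ⟨xl, hxl, hdl⟩ := hpart l (by have := norm_le_dist_add_norm (w l) (w j); linarith)
    have hne : xk ≠ xl := by
      intro h
      have h1 := hwsep k l hkl
      have h2 := dist_triangle (w k) xk (w l)
      rw [dist_comm (w k) xk, h] at h2
      rw [h] at hdk
      linarith
    have hkq : dist xk q ≤ 2 + 1 + σ := by
      have := dist_triangle xk (w k) q
      have := dist_triangle (w k) (w j) q
      linarith
    have hlq : dist xl q ≤ 2 + 1 + σ := by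
      have := dist_triangle xl (w l) q
      have := dist_triangle (w l) (w j) q
      linarith
    have hfar := hsepX xk hxk xl hxl hne hkq hlq
    have h3 := dist_triangle xk (w k) xl
    have h4 := dist_triangle (w k) (w l) xl
    rw [dist_comm (w l) xl] at h4
    linarith
  · -- twelve neighbours of w k, for w k ∈ B(w j, 2)
    have hwk : ‖w k‖ ≤ ‖q‖ + ε + 2 := by
      have := norm_le_dist_add_norm (w k) (w j)
      linarith
    obtain ⟨xk, hxk, hdk⟩ := hpart k (by linarith)
    have hxkq : dist xk q ≤ 2 + σ := by
      have := dist_triangle xk (w k) q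
      have := dist_triangle (w k) (w j) q
      linarith
    obtain ⟨T, hTX, hxkT, hTcard, hTdist⟩ := hcountX xk hxk hxkq
    -- partner particles of the points of T
    have hTpart : ∀ p' ∈ T, ∃ l : Fin N, dist p' (w l) ≤ ε := by
      intro p' hp'
      have hp'X : p' ∈ X := hTX (Finset.mem_coe.2 hp')
      have hn : ‖p'‖ ≤ R := by
        have h1 := norm_le_norm_add_dist p' xk
        have h2 := norm_le_norm_add_dist xk (w k)
        have h3 := hTdist p' hp'
        have h4 : (1 + 3 / 50) * d - σ ≤ 2 := by nlinarith
        linarith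
      obtain ⟨_, ⟨l, rfl⟩, hl⟩ := hm.2 p' hp'X hn
      exact ⟨l, hl⟩
    haveI : Nonempty (Fin N) := ⟨k⟩
    choose! lf hlf using hTpart
    have hmaps : ∀ p' ∈ T, lf p' ∈ Finset.univ.filter (fun l => l ≠ k ∧ dist (w l) (w k) ≤ (1 + 3 / 50) * d) := by
      intro p' hp'
      have hp'X : p' ∈ X := hTX (Finset.mem_coe.2 hp')
      have hne : p' ≠ xk := fun h => hxkT (h ▸ hp')
      rw [Finset.mem_filter]
      refine ⟨Finset.mem_univ _, fun hlk => ?_, ?_⟩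
      · have h1 := hXsep p' hp'X xk hxk hne
        have h2 := dist_triangle p' (w k) xk
        rw [dist_comm (w k) xk] at h2
        have h3 := hlf p' hp'
        rw [hlk] at h3
        linarith
      · have h1 := dist_triangle (w (lf p')) p' (w k)
        have h2 := dist_triangle p' xk (w k)
        rw [dist_comm (w (lf p')) p'] at h1
        have h3 := hlf p' hp'
        have h4 := hTdist p' hp'
        linarith
    have hinj : Set.InjOn lf ↑T := by
      intro p' hp' p'' hp'' hll
      by_contra hne
      have h1 := hXsep p' (hTX hp') p'' (hTX hp'') hne
      have h2 := dist_triangle p' (w (lf p')) p''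
      rw [hll, dist_comm (w (lf p'')) p''] at h2
      have h3 := hlf p' (Finset.mem_coe.1 hp')
      have h4 := hlf p'' (Finset.mem_coe.1 hp'')
      rw [hll] at h3
      linarith
    calc 12 ≤ T.card := hTcard
      _ ≤ (Finset.univ.filter (fun l => l ≠ k ∧ dist (w l) (w k) ≤ (1 + 3 / 50) * d)).card :=
          Finset.card_le_card_of_injOn lf hmaps hinj

/-- **K1, door form (PROVED):** if the rooted configuration `w` (`w c = 0`) two-way `ε`-matches on radius `12` a `δ₀`-separated set `X`
which is SLACK-NEAR its root `0` with slack `σ ≥ 4ε` (`4ε < δ₀`), then the root particle `c` is NOT `(2, 3/50, 6)`-far in `w`. -/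
theorem not_mem_farSet_of_matches {X : Set E3} {δ₀ : ℝ}
    (hXsep : ∀ p ∈ X, ∀ p' ∈ X, p ≠ p' → δ₀ ≤ dist p p')
    {N : ℕ} {w : Fin N → E3} (hwsep : ∀ k l : Fin N, k ≠ l → δ₀ ≤ dist (w k) (w l)) {c : Fin N} (hc : w c = 0)
    {σ : ℝ} {q : E3} (hqX : q ∈ X) (hq6 : dist q 0 ≤ 6 - σ) {d : ℝ} (hT : TightSlack 2 (3 / 50) d σ X q)
    {ε : ℝ} (hε : 0 < ε) (hεσ : 4 * ε ≤ σ) (hεδ : 4 * ε < δ₀)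
    (hm : (∀ p ∈ Set.range w, ‖p‖ ≤ 12 → ∃ q' ∈ X, dist q' p ≤ ε) ∧ (∀ q' ∈ X, ‖q'‖ ≤ 12 → ∃ p ∈ Set.range w, dist q' p ≤ ε)) :
    c ∉ farSet 2 (3 / 50) 6 w := by
  have hqn : ‖q‖ ≤ 6 - σ := by rwa [dist_zero_right] at hq6
  have hσ : 0 < σ := by linarith
  obtain ⟨_, ⟨j, rfl⟩, hjq⟩ := hm.2 q hqX (by linarith)
  rw [dist_comm] at hjq
  have hcert : UniformlyTightR 2 (3 / 50) d w j :=
    uniformlyTightR_of_tightSlack hXsep hwsep hT hε hεσ hεδ (by linarith) hm hjq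
  have hjc : j ∈ certSet 2 (3 / 50) w := by
    unfold certSet
    rw [Finset.mem_filter]
    exact ⟨Finset.mem_univ _, d, hcert⟩
  intro hfar
  unfold farSet at hfar
  rw [Finset.mem_filter] at hfar
  have h6 := hfar.2 j hjc
  rw [hc, dist_comm] at h6
  have := norm_le_dist_add_norm (w j) q
  rw [dist_zero_right] at hq6
  have hwj : dist (w j) 0 = ‖w j‖ := dist_zero_right _
  rw [hwj] at h6
  linarith

/-! ### §4 The residual at infinity in OPEN form implies the stub form (openness of certification) -/

/-- **(PROVED) `LimitMuGSCNear → FarLimitNotMuGSC`** — a far-rooted local limit that were a `μ`-GSC at `e⋆` would carry, by `LimitMuGSCNear`,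
a SLACK-certified point within `6 − σ` of its root, and openness of certification (`not_mem_farSet_of_matches`) would make the far roots of
the approximants NOT far. -/
theorem farLimitNotMuGSC_of_limitMuGSCNear (hL : LimitMuGSCNear) : FarLimitNotMuGSC := by
  intro X hFarX hMu
  have hLoc : IsLocLimGS X := isLocLimGS_of_isFarLocLimGS hFarX
  have hXsep := isLocLimGS_sep hLoc
  obtain ⟨h0X, x, σ, c, hgs, -, hc, hlim⟩ := hFarX
  -- the slack-certified point near the root
  obtain ⟨s, hs, q, hqX, hq6, d, hTS⟩ := hL X hLoc hMu 0 h0X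
  set ε : ℝ := min (s / 4) (1 / 8) with hεdef
  have hε : 0 < ε := lt_min (by positivity) (by norm_num)
  have hεσ : 4 * ε ≤ s := by
    have := min_le_left (s / 4) (1 / 8)
    linarith
  have hεδ : 4 * ε < 7 / 10 := by
    have := min_le_right (s / 4) (1 / 8)
    linarith
  obtain ⟨j, hj⟩ := (hlim 12 ε hε).exists
  -- the rooted approximant `W`
  have hsep : ∀ k l : Fin (σ j), k ≠ l → (7 : ℝ) / 10 ≤ dist (x (σ j) k - x (σ j) (c j)) (x (σ j) l - x (σ j) (c j)) := by
    intro k l hkl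
    rw [dist_sub_right]
    exact lennardJones_groundState_dist_ge_seven_tenths (hgs (σ j)) hkl
  have hm : (∀ p ∈ Set.range (fun k => x (σ j) k - x (σ j) (c j)), ‖p‖ ≤ 12 → ∃ q' ∈ X, dist q' p ≤ ε) ∧
      (∀ q' ∈ X, ‖q'‖ ≤ 12 → ∃ p ∈ Set.range (fun k => x (σ j) k - x (σ j) (c j)), dist q' p ≤ ε) := by
    refine ⟨?_, fun q' hq' hq'R => ?_⟩
    · rintro _ ⟨k, rfl⟩ hk
      obtain ⟨p, hp, hkp⟩ := hj.2 k hk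
      exact ⟨p, hp, by rw [dist_comm]; exact hkp⟩
    · obtain ⟨k, hk⟩ := hj.1 q' hq' hq'R
      exact ⟨_, ⟨k, rfl⟩, by rw [dist_comm]; exact hk⟩
  have hnot := not_mem_farSet_of_matches hXsep hsep (c := c j) (sub_self _) hqX hq6 hTS hε hεσ hεδ hm
  rw [farSet_sub_const] at hnot
  exact hnot (hc j)


end Summit.AtomisticToContinuum.Crystallization.Theorems.LoopTunnelDialLimitWorlds
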